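import Summits.HubbardSuperconductivity.HubbardSuperconductivity.Theorems.AnisotropyChordGroundProjectionLimit
import Summits.HubbardSuperconductivity.HubbardSuperconductivity.Theorems.AnisotropyChordChordXYGroundStateLimit
import Summits.HubbardSuperconductivity.HubbardSuperconductivity.Theorems.AnisotropyChordThermalChordEndpoints
import Literature.MathematicalPhysics.QuantumLattice.SectorGroundProjContinuity

/-!
# Route `AnisotropyChord`, crux `ChordXY` (stmt-HubbardSuperconductivity-8146), line `condensate-slab`:
# stub `stub_slabGroundStateLimit` — the ground-state limit of the SLAB condensate (def-free form, proved)

Notation: `H = H_M(Δ) = xxzHamiltonian 1 (torusGraph 2 M) (-1) Δ` (spin-½ XXZ torus of side `M`),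
`K = spinZSector 1 0` (the half-filled sector `S^z_tot = 0`), `P₀ = sectorProj M` (its orthogonal
projection), `A = condensateOp M = S⁺_tot S⁻_tot`, `𝟙` the all-ones vector of the `S^z`-basis, and the
SLAB VECTOR `v_β = e^{-βH} P₀ 𝟙` (`e^{-βH} = Matrix.gibbsWeight β H`).  The slab condensate of the line
`condensate-slab` (skeleton `Cruxes/ChordXY/Lines/condensate_slab.lean`) is the Rayleigh quotient
`Λˢ_{β,M}(Δ) = Re(⟨v_β, A v_β⟩ / ⟨v_β, v_β⟩)`.

* `rayleighQuot_smul` — the Rayleigh quotient `⟨x,Ax⟩/⟨x,x⟩` is invariant under `x ↦ s • x`, `s ≠ 0`;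
* `star_dotProduct_sectorProj_ones_ne_zero` — for a normalised sector ground state `ψ` of `H_M(Δ)`
  (`M ≥ 2`), `⟨ψ, P₀𝟙⟩ ≠ 0`: `⟨ψ, P₀𝟙⟩ = ⟨ψ, 𝟙⟩ = conj(Σ_σ ψ σ)` and `ψ` is a non-zero multiple of the
  entrywise non-negative Perron vector of the sector (`xxzSpin_sector_perron_of_connected`);
* `tendsto_slabCondensate_groundState` — **the stub with `slabVec`/`slabCondensate` unfolded**: for
  `M ≥ 2`, every real `Δ` and every normalised sector ground state `ψ` of `H_M(Δ)`,
  `Λˢ_{β,M}(Δ) ⟶ Re⟨ψ, S⁺_tot S⁻_tot ψ⟩` as `β → ∞`.  Proof: the sectorwise power method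
  `groundProjection_of_groundOverlap` (`K` is `H`-invariant, `H ≥ e₀` on `K`, the heat flow of `P₀𝟙`
  stays in `K`, `⟨ψ, P₀𝟙⟩ ≠ 0`) gives `e^{βe₀} v_β → w ≠ 0` with `w ∈ K`, `Hw = e₀w`; the sector ground
  space is the line `ℂψ` (`xxzTorus_sectorGroundSpace_unique`), so `w = cψ`, `c ≠ 0`; the Rayleigh
  quotient is scale invariant and continuous at `w ≠ 0`.

Sources: O. Bratteli, D. W. Robinson, *Operator Algebras and Quantum Statistical Mechanics II* §5.3.1
(ground states as `β → ∞` limits); H. Tasaki, *Physics and Mathematics of Quantum Many-Body Systems*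
(2020) §2.2, §4.1 (Perron–Frobenius for the stoquastic XXZ sector).  Folklore finite-dimensional
analysis; no definition is introduced; sorry-free.  HONEST: this is the easy limit stub of the line;
nothing here proves `ChordXY`, and superconductivity in the Hubbard model is not advanced.
-/

set_option linter.dupNamespace false

noncomputable section

namespace Summit.HubbardSuperconductivity.HubbardSuperconductivity.Theorems.AnisotropyChord

open Matrix Filter Topology
open scoped ComplexOrder
open Literature.MathematicalPhysics.QuantumLattice Literature.Probability.LatticeModels

/-! ### Two elementary facts -/

/-- `⟨s x, A (s x)⟩ = (s̄ s) ⟨x, A x⟩`. [folklore] -/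
theorem star_smul_dotProduct_mulVec_smul {ι : Type*} [Fintype ι] (A : Matrix ι ι ℂ) (s : ℂ)
    (x : ι → ℂ) : star (s • x) ⬝ᵥ (A *ᵥ (s • x)) = star s * s * (star x ⬝ᵥ (A *ᵥ x)) := by
  rw [mulVec_smul, star_smul, smul_dotProduct, dotProduct_smul, smul_eq_mul, smul_eq_mul, mul_assoc]

/-- **Scale invariance of the Rayleigh quotient**: `⟨sx, A sx⟩/⟨sx, sx⟩ = ⟨x, Ax⟩/⟨x, x⟩` for `s ≠ 0`.
[folklore] -/
theorem rayleighQuot_smul {ι : Type*} [Fintype ι] [DecidableEq ι] (A : Matrix ι ι ℂ) {s : ℂ}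
    (hs : s ≠ 0) (x : ι → ℂ) :
    star (s • x) ⬝ᵥ (A *ᵥ (s • x)) / (star (s • x) ⬝ᵥ (s • x)) =
      star x ⬝ᵥ (A *ᵥ x) / (star x ⬝ᵥ x) := by
  have h1 := star_smul_dotProduct_mulVec_smul A s x
  have h2 := star_smul_dotProduct_mulVec_smul (1 : Matrix ι ι ℂ) s x
  rw [one_mulVec, one_mulVec] at h2
  rw [h1, h2, mul_div_mul_left _ _ (mul_ne_zero (star_ne_zero.mpr hs) hs)]

/-! ### The overlap `⟨ψ, P₀𝟙⟩ ≠ 0` -/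

/-- **A sector ground state overlaps the polarised boundary vector**: for `M ≥ 2`, every real `Δ` and
every normalised `S^z_tot = 0` sector ground state `ψ` of `H_M(Δ)`, `⟨ψ, P₀ 𝟙⟩ ≠ 0` — indeed
`⟨ψ, P₀𝟙⟩ = ⟨P₀ψ, 𝟙⟩ = ⟨ψ, 𝟙⟩ = conj(Σ_σ ψ σ)`, and `ψ = c χ₀` with `c ≠ 0` and `χ₀ ≠ 0` entrywise
`≥ 0` (sector Perron–Frobenius, `xxzSpin_sector_perron_of_connected`). Tasaki (2020) §2.2, §4.1.
[folklore] -/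
theorem star_dotProduct_sectorProj_ones_ne_zero (M : ℕ) [NeZero M] (h2 : 2 ≤ M) (Δ : ℝ)
    {ψ : TensorIndex (TorusSite 2 M) 2 → ℂ} (hmem : ψ ∈ spinZSector (Λ := TorusSite 2 M) 1 0)
    (hψ1 : star ψ ⬝ᵥ ψ = 1)
    (heig : xxzHamiltonian 1 (torusGraph 2 M) (-1) Δ *ᵥ ψ =
      ((lowestEnergyInSector 1 (xxzHamiltonian 1 (torusGraph 2 M) (-1) Δ) 0 : ℝ) : ℂ) • ψ) :
    star ψ ⬝ᵥ (sectorProj M *ᵥ fun _ => (1 : ℂ)) ≠ 0 := by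
  set K : Submodule ℂ (TensorIndex (TorusSite 2 M) 2 → ℂ) := spinZSector (Λ := TorusSite 2 M) 1 0
    with hK
  -- `⟨ψ, P₀𝟙⟩ = ⟨ψ, 𝟙⟩`
  have hPψ : sectorProj M *ᵥ ψ = ψ := by
    rw [sectorProj_eq]
    exact projMatrix_map_mulVec_of_mem K hmem
  have hvec : star ψ ᵥ* sectorProj M = star ψ := by
    conv_lhs => rw [← (sectorProj_isHermitian M).eq]
    rw [← star_mulVec, hPψ]
  have h1 : star ψ ⬝ᵥ (sectorProj M *ᵥ fun _ => (1 : ℂ)) = star (∑ σ, ψ σ) := by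
    rw [dotProduct_mulVec, hvec, dotProduct, star_sum]
    refine Finset.sum_congr rfl fun σ _ => ?_
    rw [Pi.star_apply, mul_one]
  rw [h1, star_ne_zero]
  -- `ψ = c • χ₀`, `χ₀` the entrywise non-negative Perron vector
  have hψ0 : ψ ≠ 0 := by
    intro h
    rw [h, dotProduct_zero] at hψ1
    exact zero_ne_one hψ1
  have hKne : K ≠ ⊥ := by
    intro h
    rw [h, Submodule.mem_bot] at hmem
    exact hψ0 hmem
  haveI : Fact (1 < M) := ⟨h2⟩
  haveI : Nontrivial (TorusSite 2 M) := Pi.nontrivial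
  obtain ⟨χ₀, -, hχ0, hnn, -, huniq⟩ :=
    xxzSpin_sector_perron_of_connected 1 one_pos (torusGraph 2 M) (torusGraph_connected_of_proj 2 M)
      Δ hKne
  obtain ⟨c, hc⟩ := huniq ψ hmem heig
  have hc0 : c ≠ 0 := by
    rintro rfl
    rw [zero_smul] at hc
    exact hψ0 hc
  -- `Σ χ₀ > 0`
  have hsumpos : 0 < (∑ σ, χ₀ σ).re := by
    rw [Complex.re_sum]
    obtain ⟨σ₀, hσ₀⟩ : ∃ σ, χ₀ σ ≠ 0 := by
      by_contra h
      push Not at h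
      exact hχ0 (funext h)
    have hre : 0 < (χ₀ σ₀).re := by
      rcases (hnn σ₀).1.lt_or_eq with h | h
      · exact h
      · exfalso
        exact hσ₀ (Complex.ext (by rw [← h, Complex.zero_re]) (by rw [(hnn σ₀).2, Complex.zero_im]))
    exact Finset.sum_pos' (fun σ _ => (hnn σ).1) ⟨σ₀, Finset.mem_univ _, hre⟩
  have hsum0 : (∑ σ, χ₀ σ) ≠ 0 := fun h => by
    rw [h, Complex.zero_re] at hsumpos
    exact lt_irrefl _ hsumpos
  have hsumψ : ∑ σ, ψ σ = c * ∑ σ, χ₀ σ := by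
    rw [hc, Finset.mul_sum]
    rfl
  rw [hsumψ]
  exact mul_ne_zero hc0 hsum0

/-! ### The stub, defs unfolded -/

/-- **Registered stub `stub_slabGroundStateLimit` (line `condensate-slab` of crux `ChordXY`), with
`slabVec`/`slabCondensate` unfolded — the ground-state limit of the slab condensate.**  For `M ≥ 2`,
every real `Δ` and every normalised `S^z_tot = 0` sector ground state `ψ` of
`H_M(Δ) = xxzHamiltonian 1 (torusGraph 2 M) (-1) Δ`,
`Re(⟨v_β, S⁺_tot S⁻_tot v_β⟩/⟨v_β, v_β⟩) ⟶ Re⟨ψ, S⁺_tot S⁻_tot ψ⟩` as `β → ∞`, `v_β = e^{-βH_M(Δ)} P₀𝟙`: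
sectorwise power method (`groundProjection_of_groundOverlap`) + the sector ground space is the line
`ℂψ` (`xxzTorus_sectorGroundSpace_unique`) + scale invariance and continuity of the Rayleigh quotient.
(The hypothesis `Even M` of the registered signature is not needed.)  Bratteli–Robinson II §5.3.1;
Tasaki (2020) §2.2, §4.1. [folklore] -/
theorem tendsto_slabCondensate_groundState (M : ℕ) [NeZero M] (h2 : 2 ≤ M) (Δ : ℝ)
    (ψ : TensorIndex (TorusSite 2 M) 2 → ℂ) (hmem : ψ ∈ spinZSector (Λ := TorusSite 2 M) 1 0)
    (hψ1 : star ψ ⬝ᵥ ψ = 1)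
    (heig : xxzHamiltonian 1 (torusGraph 2 M) (-1) Δ *ᵥ ψ =
      ((lowestEnergyInSector 1 (xxzHamiltonian 1 (torusGraph 2 M) (-1) Δ) 0 : ℝ) : ℂ) • ψ) :
    Tendsto (fun β : ℝ =>
      ((star (gibbsWeight β (xxzHamiltonian 1 (torusGraph 2 M) (-1) Δ) *ᵥ
            (sectorProj M *ᵥ fun _ => (1 : ℂ))) ⬝ᵥ
          (condensateOp M *ᵥ (gibbsWeight β (xxzHamiltonian 1 (torusGraph 2 M) (-1) Δ) *ᵥ
            (sectorProj M *ᵥ fun _ => (1 : ℂ))))) /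
        (star (gibbsWeight β (xxzHamiltonian 1 (torusGraph 2 M) (-1) Δ) *ᵥ
            (sectorProj M *ᵥ fun _ => (1 : ℂ))) ⬝ᵥ
          (gibbsWeight β (xxzHamiltonian 1 (torusGraph 2 M) (-1) Δ) *ᵥ
            (sectorProj M *ᵥ fun _ => (1 : ℂ))))).re) atTop
      (𝓝 ((star ψ ⬝ᵥ ((∑ x : TorusSite 2 M, onSite x (spinRaise 1)) *
        (∑ y : TorusSite 2 M, onSite y (spinLower 1))) *ᵥ ψ).re)) := by
  set H : Matrix (TensorIndex (TorusSite 2 M) 2) (TensorIndex (TorusSite 2 M) 2) ℂ :=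
    xxzHamiltonian 1 (torusGraph 2 M) (-1) Δ with hHdef
  set K : Submodule ℂ (TensorIndex (TorusSite 2 M) 2 → ℂ) := spinZSector (Λ := TorusSite 2 M) 1 0
    with hKdef
  set A : Matrix (TensorIndex (TorusSite 2 M) 2) (TensorIndex (TorusSite 2 M) 2) ℂ :=
    condensateOp M with hAdef
  set E : ℝ := lowestEnergyInSector 1 H 0 with hEdef
  set u : TensorIndex (TorusSite 2 M) 2 → ℂ := sectorProj M *ᵥ fun _ => (1 : ℂ) with hudef
  have hH : H.IsHermitian := xxzHamiltonian_isHermitian 1 (torusGraph 2 M) (-1) Δ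
  have hC : Commute H (totalSpin 1 2) :=
    HardCoreBoson.commute_xxzHamiltonian_totalSpin_two 1 (torusGraph 2 M) (-1) Δ
  have hinv : ∀ x ∈ K, H *ᵥ x ∈ K := fun x hx => XXZKT.mulVec_mem_spinZSector_of_commute hC hx
  have hE : ∀ x ∈ K, E * (star x ⬝ᵥ x).re ≤ (star x ⬝ᵥ H *ᵥ x).re :=
    fun x hx => minEnergyOn_mul_le_re_rayleigh hH K hx
  have huK : u ∈ K := by
    rw [hudef, sectorProj_eq]
    exact projMatrix_map_mulVec_mem K _
  have hψu : star ψ ⬝ᵥ u ≠ 0 := star_dotProduct_sectorProj_ones_ne_zero M h2 Δ hmem hψ1 heig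
  have hflowK : ∀ t : ℝ, 0 ≤ t → NormedSpace.exp (-(t : ℂ) • H) *ᵥ u ∈ K := fun t _ =>
    XXZKT.mulVec_mem_spinZSector_of_commute ((hC.smul_left (-(t : ℂ))).exp_left) huK
  obtain ⟨w, hwK, hw0, hHw, hlim⟩ :=
    groundProjection_of_groundOverlap H hH K hinv E hE ψ heig u huK hψu hflowK
  -- `w = c • ψ`, `c ≠ 0`
  have hwE₀ : w ∈ K ⊓ Module.End.eigenspace (Matrix.toLin' H) ((H.minEnergyOn K : ℝ) : ℂ) := by
    refine Submodule.mem_inf.mpr ⟨hwK, Module.End.mem_eigenspace_iff.mpr ?_⟩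
    rw [Matrix.toLin'_apply]
    exact hHw
  obtain ⟨c, hc⟩ := xxzTorus_sectorGroundSpace_unique M h2 Δ hmem hψ1 heig w hwE₀
  have hc0 : c ≠ 0 := by
    rintro rfl
    rw [zero_smul] at hc
    exact hw0 hc
  have hww : star w ⬝ᵥ w ≠ 0 := fun h => hw0 (dotProduct_star_self_eq_zero.mp h)
  -- the rescaled flow and the Rayleigh quotient along it
  set flow : ℝ → TensorIndex (TorusSite 2 M) 2 → ℂ :=
    fun β => ((Real.exp (β * E) : ℝ) : ℂ) • (NormedSpace.exp (-(β : ℂ) • H) *ᵥ u) with hflow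
  have hnum : Tendsto (fun β => star (flow β) ⬝ᵥ (A *ᵥ flow β)) atTop (𝓝 (star w ⬝ᵥ (A *ᵥ w))) := by
    have hcont : Continuous fun x : TensorIndex (TorusSite 2 M) 2 → ℂ => star x ⬝ᵥ (A *ᵥ x) :=
      continuous_star.dotProduct (continuous_const.matrix_mulVec continuous_id)
    exact (hcont.tendsto w).comp hlim
  have hden : Tendsto (fun β => star (flow β) ⬝ᵥ flow β) atTop (𝓝 (star w ⬝ᵥ w)) := by
    have hcont : Continuous fun x : TensorIndex (TorusSite 2 M) 2 → ℂ => star x ⬝ᵥ x :=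
      continuous_star.dotProduct continuous_id
    exact (hcont.tendsto w).comp hlim
  have hquot := (Complex.continuous_re.tendsto _).comp (hnum.div hden hww)
  -- identify the function
  have hfun : (fun β : ℝ =>
      ((star (gibbsWeight β H *ᵥ u) ⬝ᵥ (A *ᵥ (gibbsWeight β H *ᵥ u))) /
        (star (gibbsWeight β H *ᵥ u) ⬝ᵥ (gibbsWeight β H *ᵥ u))).re) =
      (fun β : ℝ => ((fun β => star (flow β) ⬝ᵥ (A *ᵥ flow β)) /
        (fun β => star (flow β) ⬝ᵥ flow β)) β |>.re) := by
    funext β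
    have hexp : ((Real.exp (β * E) : ℝ) : ℂ) ≠ 0 :=
      Complex.ofReal_ne_zero.mpr (Real.exp_pos _).ne'
    rw [Pi.div_apply, hflow]
    simp only []
    rw [rayleighQuot_smul A hexp]
    rfl
  -- identify the limit
  have hval : (star w ⬝ᵥ (A *ᵥ w) / (star w ⬝ᵥ w)).re =
      (star ψ ⬝ᵥ ((∑ x : TorusSite 2 M, onSite x (spinRaise 1)) *
        (∑ y : TorusSite 2 M, onSite y (spinLower 1))) *ᵥ ψ).re := by
    rw [hc, rayleighQuot_smul A hc0, hψ1, div_one, hAdef, condensateOp_eq]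
  rw [hfun, ← hval]
  exact hquot

end Summit.HubbardSuperconductivity.HubbardSuperconductivity.Theorems.AnisotropyChord

end
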